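import Summits.QuantumFields.YangMills.Theses.BalabanLadder
import Summits.QuantumFields.YangMills.Theorems.BalabanLadderIRStubRungStrong

/-!
# Crux `IR` (item stmt-QuantumFields-19354, route-QuantumFields-BalabanLadder) — vocabulary of the line
«es-polymer-decoupling» (ideator ym-ir-idea-1; engine + rung pooled to the lead ym-ir-line-mxc-p1 by director-ym R366)

Helper module for item `stmt-QuantumFields-19354` (`--supports … --as helper`; it closes nothing).  Route-posited objects
of the skeleton `Cruxes/IR/Lines/es_polymer_decoupling.lean` (ideator ym-ir-idea-1 g0, critics crit-1/crit-2 PASS-WITH-PRICE),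
made tree constants so that the provable stubs `EsPolymer.stub_polymerEngine : PolymerEngine` (abstract Kotecký–Preiss engine)
and `EsPolymer.stub_esRung : ESRung` (strong-coupling Kandel–Domany / Edwards–Sokal cell-deletion representation) can be closed
by `Theorems/` files proving constants of THIS module by name, and so that the skeleton re-bases on
`import …Theorems.IR.EsPolymerDefs` (pattern of `Theorems/IR/ShellMaxCorrDefs.lean`).  NOTHING here is asserted: every
`def … : Prop` is a line statement that a stub proves or consumes; none is a literature fact; none restates the crux as a
claim (`IRPolymerCert` is STRONGER than the crux and carries the whole price — see its docstring; it is NOT staffed, R366).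

Delta against the ideator's skeleton bytes (hygiene): Mathlib's `DependsOn f E` replaces the skeleton's private
`DependsOn E f` predicate (argument order swapped accordingly in `DPR`); everything else is VERBATIM (§1 grids/cells/blocks,
§2 polymers/compatibility/owners, §3 `DPR`, `DPRInUnits`, `PolymerEngine`, `IRPolymerCert`, `ESRung`, the composition
`irCal_of_polymer` and `IRCal`); the stubs themselves are NOT here.

HONEST FRAMING: vocabulary for ONE open gap-crux of a CONDITIONAL chain (R4 closes only the finite-𝕋⁴ UV rung
`BalabanLadder.UV`); the Props are hypotheses; nothing here proves a polymer representation at weak coupling, a lattice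
mass gap, or the Clay Yang–Mills problem.  Prior art for the rung's mechanism (Kandel–Domany freeze/delete, Kawashima–
Gubernatis) is typed in `Literature/MathematicalPhysics/QuantumFieldTheory/KandelDomanyRepresentation.lean`.

Refs: line card `Cruxes/IR/Lines/es-polymer-decoupling.md`; R. Kotecký, D. Preiss, CMP 103 (1986) 491; D. Kandel, E. Domany,
Phys. Rev. B 43 (1991) 8539; L. Chayes, J. Machta, Physica A 254 (1998) 477.
-/

set_option autoImplicit false

noncomputable section

open Filter Topology MeasureTheory
open Literature.MathematicalPhysics.QuantumFieldTheory Literature.MathematicalPhysics.QuantumLattice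
open Summit.QuantumFields.YangMills.Cruxes.OSLegsFromFemtoAndGap.DlrCollarTransfer (GapInUnits LowerBounds)
open Summit.QuantumFields.YangMills.Cruxes.IR.Tempered (cellEdges)

namespace Summit.QuantumFields.YangMills.Cruxes.IR.EsPolymer

/-! ## §1 Periodic cell grids on the torus of side `N`, cell distance, block-local observables -/

/-- A grid `w` of mesh `b` adapted to the torus of side `N` with `q` cells per direction: origin at `0`, cell sides in
`[b, 2b]`, and index-period `q` ↔ space-period `N`. (Ragged meshes are how `N = 2S+1 ≢ 0 mod b` is handled, as in
the tree's L2″ grids.) -/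
def IsGrid (N b q : ℕ) (w : Fin 4 → ℤ → ℤ) : Prop :=
  0 < q ∧ (∀ i, w i 0 = 0) ∧ (∀ i j, w i j + (b : ℤ) ≤ w i (j + 1) ∧ w i (j + 1) ≤ w i j + 2 * (b : ℤ)) ∧
    (∀ i j, w i (j + (q : ℤ)) = w i j + (N : ℤ))

/-- Cells of the cell-torus with `q` cells per direction. -/
abbrev Cell (q : ℕ) : Type := Fin 4 → Fin q

/-- Distance from `0` on the cycle `ℤ/q` (elements as `Fin q`). -/
def cycAbs {q : ℕ} (z : Fin q) : ℕ := min z.val (q - z.val)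

/-- Sup-distance of two cells on the cell-torus. -/
def cellDist {q : ℕ} (c c' : Cell q) : ℕ := Finset.univ.sup fun i => cycAbs (c i - c' i)

/-- Torus edges of cell `c` (the grid cell with integer index `(c i).val`, projected mod `N`). -/
def torusCellEdges (N q : ℕ) (w : Fin 4 → ℤ → ℤ) (c : Cell q) : Finset (Edge 4 N) :=
  (cellEdges w fun i => ((c i).val : ℤ)).image (torusEdge N)

/-- Edges of the block of cell-radius `R` about `c`. -/
def blockEdges (N q : ℕ) (w : Fin 4 → ℤ → ℤ) (c : Cell q) (R : ℕ) : Set (Edge 4 N) :=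
  {e | ∃ c' : Cell q, cellDist c c' ≤ R ∧ e ∈ torusCellEdges N q w c'}

/-! ## §2 Polymers, compatible families, owners -/

/-- A polymer: a nonempty set of cells, connected with steps of cell-distance `≤ 6`. -/
def IsPolymer {q : ℕ} (γ : Finset (Cell q)) : Prop :=
  γ.Nonempty ∧ ∀ c ∈ γ, ∀ c' ∈ γ, Relation.ReflTransGen (fun x y => x ∈ γ ∧ y ∈ γ ∧ cellDist x y ≤ 6) c c'

/-- A compatible family: polymers pairwise at cell-distance `≥ 7` (hard core). -/
def Compatible {q : ℕ} (Γ : Finset (Finset (Cell q))) : Prop :=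
  (∀ γ ∈ Γ, IsPolymer γ) ∧ ∀ γ ∈ Γ, ∀ γ' ∈ Γ, γ ≠ γ' → ∀ c ∈ γ, ∀ c' ∈ γ', 7 ≤ cellDist c c'

/-- The owner of cell `c` in the family `Γ`: the union of the polymers of `Γ` within cell-distance `2` of `c` (under
`Compatible Γ` there is at most one; `∅` = unowned, i.e. the radius-1 block about `c` sees only free links). -/
def owner {q : ℕ} (Γ : Finset (Finset (Cell q))) (c : Cell q) : Finset (Cell q) :=
  (Γ.filter fun γ => ∃ c' ∈ γ, cellDist c c' ≤ 2).sup id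

/-! ## §3 The decoupling–polymer representation and the three statements -/

section Measure

variable {G : Type} [Group G] [TopologicalSpace G] [IsTopologicalGroup G] [CompactSpace G]
  [MeasurableSpace G] [BorelSpace G]

/-- **`DPR ρ β S b p` — decoupling–polymer representation of the torus Wilson measure (side `2S+1`) at mesh `b` with
Peierls parameter `p`.**  Data: a grid, activities `act`, a normalisation `Z`, and sub-measures `ν_Γ` indexed by
families of cell sets, with: (P) `0 ≤ act γ ≤ p^{|γ|}`; `ν_Γ = 0` off compatible families; `Σ_Γ ν_Γ = μ`;
`ν_Γ(1) = Z⁻¹ ∏_{γ∈Γ} act γ` (hard-core polymer gas; summing, `Z = Σ_Γ ∏ act ≥ 1` is forced since `μ` is a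
probability measure, so `P(γ ∈ Γ) ≤ act γ ≤ p^{|γ|}`: Peierls); (I) under `ν_Γ`, bounded measurable observables on
the radius-1 blocks about cells `c_A`, `c_B` at cell-distance `≥ 4` (blocks separated by at least one full cell —
NEVER adjacent: local stiffness at weak coupling forbids independence of adjacent blocks under any non-negligible
piece of `μ`, cf. the 1D regeneration model in the line card) with `owner Γ c_A ≠ owner Γ c_B`, or both unowned, are
exactly independent; (D) the `ν_Γ`-mean of a block observable is `ν_Γ(1) · Φ_A (owner Γ c_A)` for a function `Φ_A`
of the owner alone (all residual long-range dependence is carried by the hard-core gas).  MODELS: Edwards–Sokal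
deletion at strong coupling (`stub_esRung`); Nummelin splitting of the cell-boundary chain for every massive
compact-spin CHAIN at mesh `ℓ ≫ ξ` (d = 1, `p = 1 − ε_ℓ → 0`; line card §toy) — the format is not a
high-temperature artefact. -/
def DPR {n : ℕ} (ρ : G →* Matrix (Fin n) (Fin n) ℂ) (β : ℝ) (S b : ℕ) (p : ℝ) : Prop :=
  ∃ (q : ℕ) (w : Fin 4 → ℤ → ℤ), IsGrid (2 * S + 1) b q w ∧
    ∃ (act : Finset (Cell q) → ℝ) (Z : ℝ)
      (ν : Finset (Finset (Cell q)) → Measure (GaugeConfig 4 (2 * S + 1) G)),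
      0 < Z ∧ (∀ γ, 0 ≤ act γ ∧ act γ ≤ p ^ γ.card) ∧
      (∀ Γ, ¬ Compatible Γ → ν Γ = 0) ∧
      (Finset.univ.sum ν = wilsonMeasure (d := 4) (L := 2 * S + 1) ρ β) ∧
      (∀ Γ, Compatible Γ → (ν Γ Set.univ).toReal = Z⁻¹ * ∏ γ ∈ Γ, act γ) ∧
      (∀ Γ, Compatible Γ → ∀ (cA cB : Cell q) (A B : GaugeConfig 4 (2 * S + 1) G → ℝ),
          Measurable A → Measurable B → (∃ C, ∀ U, |A U| ≤ C) → (∃ C, ∀ U, |B U| ≤ C) →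
          DependsOn A (blockEdges (2 * S + 1) q w cA 1) → DependsOn B (blockEdges (2 * S + 1) q w cB 1) →
          4 ≤ cellDist cA cB → (owner Γ cA ≠ owner Γ cB ∨ (owner Γ cA = ∅ ∧ owner Γ cB = ∅)) →
            (ν Γ Set.univ).toReal * ∫ U, A U * B U ∂(ν Γ) = (∫ U, A U ∂(ν Γ)) * (∫ U, B U ∂(ν Γ))) ∧
      (∀ (cA : Cell q) (A : GaugeConfig 4 (2 * S + 1) G → ℝ), Measurable A → (∃ C, ∀ U, |A U| ≤ C) →
          DependsOn A (blockEdges (2 * S + 1) q w cA 1) →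
            ∃ Φ : Finset (Cell q) → ℝ, ∀ Γ, Compatible Γ →
              ∫ U, A U ∂(ν Γ) = (ν Γ Set.univ).toReal * Φ (owner Γ cA))

/-- The representation in physical units with Peierls parameter `p`: at some physical mesh `ℓ`, for all large `β`
and all large tori. -/
def DPRInUnits (r : LatticeRep G) (a : ℝ → ℝ) (p : ℝ) : Prop :=
  ∃ (ℓ β₂ : ℝ) (S₁ : ℝ → ℕ), 0 < ℓ ∧ ∀ β : ℝ, β₂ ≤ β → ∀ S : ℕ, S₁ β ≤ S → DPR r.ρ β S ⌈ℓ / a β⌉₊ p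

end Measure

/-- **ENGINE (provable; abstract Kotecký–Preiss on the hard-core cell-polymer gas + clauses (I)(D)).**  There is a
universal `p₀ > 0` (any `p₀` with `p₀ · e · 13⁴ < 1` works: radius-6 cell animals in `ℤ⁴`) such that a
decoupling–polymer representation with Peierls parameter `p₀` at a physical mesh, eventually in `β` and `S`, gives
`GapInUnits` (rate `∝ |log (e 13⁴ p₀)| · a/ℓ`, constants `4‖A‖∞‖B‖∞ ×` a KP sum).  Group-blind, no simplicity. -/
def PolymerEngine : Prop :=
  ∃ p₀ : ℝ, 0 < p₀ ∧
    ∀ (G : Type) [Group G] [TopologicalSpace G] [IsTopologicalGroup G] [CompactSpace G],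
      letI : MeasurableSpace G := borel G; haveI : BorelSpace G := ⟨rfl⟩;
      ∀ (r : LatticeRep G) (a : ℝ → ℝ), (∀ β, 0 < a β) → Tendsto a atTop (𝓝 0) →
        DPRInUnits r a p₀ → GapInUnits G r a

/-- **THE CRUX of R2c in polymer form.**  For compact SIMPLE `G`: non-triviality in units `a` forces, for EVERY
Peierls parameter `p > 0`, a decoupling–polymer representation at some physical mesh `ℓ(p)`, eventually in `β` and on
all large tori.  False with a `U(1)` factor (massless photon: block means at cell-distance `D` keep covariance
`≍ D^{-4}` in physical units, incompatible with (I)(D)(P) at any fixed `p < p₀`), so simplicity is load-bearing;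
centre-free. -/
def IRPolymerCert : Prop :=
  ∀ (G : Type) [Group G] [TopologicalSpace G] [IsTopologicalGroup G] [CompactSpace G],
    IsCompactSimpleLieGroup G → letI : MeasurableSpace G := borel G; haveI : BorelSpace G := ⟨rfl⟩;
    ∀ (r : LatticeRep G) (a : ℝ → ℝ), (∀ β, 0 < a β) → Tendsto a atTop (𝓝 0) →
      LowerBounds G r a → ∀ p : ℝ, 0 < p → DPRInUnits r a p

/-- **RUNG (strong coupling, mesh 1, every torus; the Edwards–Sokal deletion of cell Boltzmann factors).**  For every
`p > 0` there is `β₀(n, p) > 0` with `DPR ρ β S 1 p` for all `|β| ≤ β₀` and all `S`: write each site-cell factor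
`W_c = exp(−β Σ_{plaquettes based at c}(n − Re tr ρ U_p)) ∈ [m, 1]`, `m = e^{−12nβ}`, as `m·(1 + (W_c/m − 1))`,
expand, group retained cells into radius-6 components; footprints of distinct components are disjoint, so the Haar
integral factorises: `act γ = ∫ ∏_{c∈γ} (W_c/m − 1) dHaar ≤ (e^{12nβ} − 1)^{|γ|}`. -/
def ESRung : Prop :=
  ∀ (G : Type) [Group G] [TopologicalSpace G] [IsTopologicalGroup G] [CompactSpace G]
    [MeasurableSpace G] [BorelSpace G] (n : ℕ) (ρ : G →* Matrix (Fin n) (Fin n) ℂ), Continuous ρ →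
    ∀ p : ℝ, 0 < p → ∃ β₀ : ℝ, 0 < β₀ ∧ ∀ β : ℝ, |β| ≤ β₀ → ∀ S : ℕ, DPR ρ β S 1 p

/-! ## §4 The composition concluding `BalabanLadder.IR` BY NAME -/

/-- `IR`'s body verbatim (pattern of `Cruxes/IR/Lines/birth.lean`). -/
def IRCal : Prop :=
  ∀ (G : Type) [Group G] [TopologicalSpace G] [IsTopologicalGroup G] [CompactSpace G],
    IsCompactSimpleLieGroup G → letI : MeasurableSpace G := borel G; haveI : BorelSpace G := ⟨rfl⟩;
    ∀ (r : LatticeRep G) (a : ℝ → ℝ), (∀ β, 0 < a β) → Tendsto a atTop (𝓝 0) →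
      LowerBounds G r a → GapInUnits G r a

/-- Composition (real proof): engine + crux ⇒ `IRCal` (the crux is applied at the engine's threshold `p₀`). -/
theorem irCal_of_polymer (hE : PolymerEngine) (hC : IRPolymerCert) : IRCal := by
  obtain ⟨p₀, hp₀, hE⟩ := hE
  intro G _ _ _ _ hG
  letI : MeasurableSpace G := borel G
  haveI : BorelSpace G := ⟨rfl⟩
  intro r a ha ha0 hlb
  exact hE G r a ha ha0 (hC G hG r a ha ha0 hlb p₀ hp₀)


/-- **Composition (real proof, hypotheses form): engine + load ⇒ the route decl `BalabanLadder.IR` BY NAME.**  The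
skeleton's `IR_of` is `ir_of_polymer stub_polymerEngine stub_polymerCert`. -/
theorem ir_of_polymer (hE : PolymerEngine) (hC : IRPolymerCert) :
    Summit.QuantumFields.YangMills.Theses.BalabanLadder.IR := by
  have h : IRCal := irCal_of_polymer hE hC
  delta Summit.QuantumFields.YangMills.Theses.BalabanLadder.IR
  delta Summit.QuantumFields.YangMills.Cruxes.IR.EsPolymer.IRCal at h
  exact h

end Summit.QuantumFields.YangMills.Cruxes.IR.EsPolymer

end
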